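import Literature.Probability.RandomPlanarGeometry.SAWBendingEnergy
import Mathlib.Analysis.SpecialFunctions.Pow.Real
import Mathlib.Topology.Order.Basic
import HarnessLib

/-!
# The stiff-free end of the bending-energy curve: `κ(t) − log t ↘ log μ_AT` as `t → ∞` (lane «STIFF-∞», part 1)

Topic `Literature/Probability/RandomPlanarGeometry` (continues `SAWBendingEnergy.lean` — `Zd.turns`, `Zd.Zbend`,
`Zd.bendFE t = κ(t) = ⨅_N log(max(1,t) Z_{N+1}(t))/(N+1)`, the step-word model `wturns`, `Zbend_eq_sum_sawWords` —
and `SAWWords.lean`).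

Statement (a-idea-2 gen 8, `Sketch_v7_add4.lean` e4876707b834bb5c, «STIFF-∞», bodies verbatim): with
`a(N)` = the number of ALL-TURN `N`-step self-avoiding walks on `ℤ²` (`turns = N − 1`) and
`log μ_AT := ⨅_N log a(N+1)/(N+1)`:
* `EndpointLower`    : `log t + log μ_AT ≤ κ(t)` for every `t ≥ 1`;
* `EndpointAntitone` : `t ↦ κ(t) − log t` is nonincreasing on `[1, ∞)`;
* `EndpointLimit`    : `κ(t) − log t → log μ_AT` as `t → ∞`.
Mechanism: for `t > 0`, `Z_{N+1}(t) = t^N · S_N(t)` with `S_N(t) = Σ_{w ∈ SAW_{N+1}} (1/t)^{N − turns(w)}` — every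
exponent is `≥ 0`, so `S_N` is nonincreasing in `t`, `S_N(t) ≥ a(N+1) ≥ 1` (the staircase is an all-turn walk), and
`S_N(t) → a(N+1)` as `t → ∞`; the three statements follow through `⨅_N` by `ciInf_le` / `le_ciInf` and the order
characterisation of the limit. (For WALKS the free energy is an infimum — submultiplicativity — which is what makes
the endpoint elementary; for polygons it is a supremum and the corresponding continuity at curvature density `1` is
"not established", Janse van Rensburg 2015, §5.3.1, p. 167, after Thm 5.46.)

## Contents
* word level (namespace `…SAW`): `wturns_le_length_sub_one`, `stairWord`, `isSAW_stairWord`, `wturns_stairWord`,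
  `allTurnWords`, `stairWord_mem_allTurnWords`, `tailSum` (`S_N`), `Zbend_succ_eq_pow_mul_tailSum`,
  `card_allTurnWords_le_tailSum`, `tailSum_antitoneOn`, `tendsto_tailSum_atTop`;
* walk level (namespace `…SAW.Zd`): `allTurnCount`, `logMuAT` (a-idea-2's bodies verbatim),
  `allTurnCount_eq_card_allTurnWords`, `one_le_allTurnCount`, `logMuAT_le`, `bendFE_term_eq`,
  **`endpointLower`**, **`endpointAntitone`**, **`endpointLimit`** (a-idea-2's `EndpointLower/Antitone/Limit`,
  bodies verbatim as theorem types).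
[cite: MadrasSlade1993, §1.2 (subadditivity) and §2.1; JansevanRensburg2015, §5.3.1 (p. 167)]
-/

noncomputable section

open Finset Filter Topology
open scoped BigOperators
open Literature.Probability.LatticeModels

namespace Literature.Probability.RandomPlanarGeometry.SAW

/-! ### Word level -/

/-- A word of length `M` has at most `M − 1` turns. [cite: MadrasSlade1993, §1.1] -/
theorem wturns_le_length_sub_one : ∀ w : List Step, wturns w ≤ w.length - 1
  | [] => by simp
  | [a] => by simp
  | a :: b :: w => by
    have ih := wturns_le_length_sub_one (b :: w)
    simp only [wturns_cons_cons, List.length_cons] at ih ⊢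
    split_ifs <;> omega

/-- The staircase word `0, 1, 0, 1, …` (east, north, east, north, …) of length `M`. [cite: MadrasSlade1993, §1.1] -/
def stairWord : ℕ → List Step
  | 0 => []
  | M + 1 => (if M % 2 = 0 then (0 : Step) else 1) :: stairWord M

/-- Length of the staircase word. [cite: MadrasSlade1993, §1.1] -/
@[simp] theorem length_stairWord : ∀ M : ℕ, (stairWord M).length = M
  | 0 => rfl
  | M + 1 => by simp [stairWord, length_stairWord M]

/-- Each staircase step increases `x + y` by one, so after `i ≤ M` steps `x + y = i`. [cite: MadrasSlade1993, §1.1] -/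
theorem traj_stairWord_sum : ∀ (M i : ℕ), i ≤ M → traj (stairWord M) i 0 + traj (stairWord M) i 1 = i
  | 0, i, hi => by
    have : i = 0 := by omega
    subst this; simp
  | M + 1, 0, _ => by simp
  | M + 1, i + 1, hi => by
    rw [stairWord, traj_cons_succ]
    have ih := traj_stairWord_sum M i (by omega)
    simp only [Pi.add_apply, Step.vec_apply_zero, Step.vec_apply_one]
    push_cast
    split_ifs <;> simp [Step.dx, Step.dy] <;> linarith

/-- The staircase word is self-avoiding (`x + y` is injective along it). [cite: MadrasSlade1993, §1.1] -/
theorem isSAW_stairWord (M : ℕ) : IsSAW (stairWord M) := by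
  rw [isSAW_iff_injOn]
  intro i hi j hj hij
  simp only [Set.mem_setOf_eq, length_stairWord] at hi hj
  have h1 := traj_stairWord_sum M i hi
  have h2 := traj_stairWord_sum M j hj
  have : (i : ℤ) = j := by rw [← h1, ← h2, hij]
  exact_mod_cast this

/-- The recursion of the staircase word. [cite: MadrasSlade1993, §1.1] -/
theorem stairWord_succ (M : ℕ) : stairWord (M + 1) = (if M % 2 = 0 then (0 : Step) else 1) :: stairWord M := rfl

/-- The staircase word turns at every internal vertex. [cite: MadrasSlade1993, §1.1] -/
theorem wturns_stairWord : ∀ M : ℕ, wturns (stairWord M) = M - 1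
  | 0 => rfl
  | 1 => rfl
  | M + 2 => by
    have ih := wturns_stairWord (M + 1)
    rw [stairWord_succ (M + 1), stairWord_succ M, wturns_cons_cons, ← stairWord_succ M, ih]
    have hne : (if (M + 1) % 2 = 0 then (0 : Step) else 1) ≠ (if M % 2 = 0 then (0 : Step) else 1) := by
      rcases Nat.mod_two_eq_zero_or_one M with h | h
      · rw [if_neg (by omega), if_pos h]; decide
      · have h' : (M + 1) % 2 = 0 := by omega
        rw [if_pos h', if_neg (by omega)]; decide
    rw [if_neg hne]
    omega

/-- The all-turn self-avoiding words of length `M` (`wturns = M − 1`). [cite: MadrasSlade1993, §1.1] -/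
def allTurnWords (M : ℕ) : Finset (List Step) := (sawWords M).filter fun w => wturns w = M - 1

/-- Membership in `allTurnWords`. [cite: MadrasSlade1993, §1.1] -/
theorem mem_allTurnWords {M : ℕ} {w : List Step} :
    w ∈ allTurnWords M ↔ w.length = M ∧ IsSAW w ∧ wturns w = M - 1 := by
  rw [allTurnWords, Finset.mem_filter, mem_sawWords, and_assoc]

/-- The staircase is an all-turn self-avoiding word. [cite: MadrasSlade1993, §1.1] -/
theorem stairWord_mem_allTurnWords (M : ℕ) : stairWord M ∈ allTurnWords M :=
  mem_allTurnWords.2 ⟨length_stairWord M, isSAW_stairWord M, wturns_stairWord M⟩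

/-- `S_N(t) := Σ_{w ∈ SAW_{N+1}} (1/t)^{N − turns(w)}`, the bending partition function with the all-turn weight
factored out. [cite: MadrasSlade1993, §1.1] -/
def tailSum (N : ℕ) (t : ℝ) : ℝ := ∑ w ∈ sawWords (N + 1), t⁻¹ ^ (N - wturns w)

/-- `Z_{N+1}(t) = t^N · S_N(t)` for `t ≠ 0`. [cite: MadrasSlade1993, §1.1] -/
theorem Zbend_succ_eq_pow_mul_tailSum (N : ℕ) {t : ℝ} (ht : t ≠ 0) :
    Zd.Zbend (N + 1) t = t ^ N * tailSum N t := by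
  rw [Zbend_eq_sum_sawWords, tailSum, Finset.mul_sum]
  refine Finset.sum_congr rfl fun w hw => ?_
  have hle : wturns w ≤ N := by
    have := wturns_le_length_sub_one w
    rw [(mem_sawWords.1 hw).1] at this
    simpa using this
  obtain ⟨k, hk⟩ : ∃ k, N = wturns w + k := ⟨N - wturns w, by omega⟩
  rw [show N - wturns w = k by omega, hk, pow_add, inv_pow, mul_assoc, mul_inv_cancel₀ (pow_ne_zero _ ht),
    mul_one]

/-- Every all-turn word contributes `1` to `S_N(t)`: `a(N+1) ≤ S_N(t)` (`t > 0`). [cite: MadrasSlade1993, §1.1] -/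
theorem card_allTurnWords_le_tailSum (N : ℕ) {t : ℝ} (ht : 0 < t) :
    ((allTurnWords (N + 1)).card : ℝ) ≤ tailSum N t := by
  rw [tailSum, allTurnWords, Finset.card_eq_sum_ones, Nat.cast_sum, Finset.sum_filter]
  refine Finset.sum_le_sum fun w _ => ?_
  split_ifs with h
  · rw [h, show N - (N + 1 - 1) = 0 by omega, pow_zero]; norm_num
  · positivity

/-- `S_N(t) ≥ 1` (`t > 0`): the staircase. [cite: MadrasSlade1993, §1.1] -/
theorem one_le_tailSum (N : ℕ) {t : ℝ} (ht : 0 < t) : 1 ≤ tailSum N t := by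
  refine le_trans ?_ (card_allTurnWords_le_tailSum N ht)
  exact_mod_cast Finset.card_pos.2 ⟨_, stairWord_mem_allTurnWords (N + 1)⟩

/-- `S_N` is nonincreasing on `(0, ∞)`: every exponent `N − turns(w)` is `≥ 0`. [cite: MadrasSlade1993, §1.1] -/
theorem tailSum_antitoneOn (N : ℕ) : AntitoneOn (tailSum N) (Set.Ioi 0) := by
  intro s hs t ht hst
  have hs' : (0 : ℝ) < s := hs
  have ht' : (0 : ℝ) < t := ht
  refine Finset.sum_le_sum fun w _ => ?_
  exact pow_le_pow_left₀ (inv_nonneg.2 ht'.le) ((inv_le_inv₀ ht' hs').2 hst) _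

/-- `S_N(t) → a(N+1)` as `t → ∞`. [cite: MadrasSlade1993, §1.1] -/
theorem tendsto_tailSum_atTop (N : ℕ) :
    Tendsto (tailSum N) atTop (𝓝 ((allTurnWords (N + 1)).card : ℝ)) := by
  have hlim : ∀ w ∈ sawWords (N + 1), Tendsto (fun t : ℝ => t⁻¹ ^ (N - wturns w)) atTop
      (𝓝 (if wturns w = N + 1 - 1 then (1 : ℝ) else 0)) := by
    intro w hw
    have hle : wturns w ≤ N := by
      have := wturns_le_length_sub_one w
      rw [(mem_sawWords.1 hw).1] at this
      simpa using this
    split_ifs with h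
    · rw [h, show N - (N + 1 - 1) = 0 by omega]
      simp
    · have hk : N - wturns w ≠ 0 := by omega
      have := (tendsto_inv_atTop_zero (𝕜 := ℝ)).pow (N - wturns w)
      rwa [zero_pow hk] at this
  have hsum : ((allTurnWords (N + 1)).card : ℝ) =
      ∑ w ∈ sawWords (N + 1), (if wturns w = N + 1 - 1 then (1 : ℝ) else 0) := by
    rw [allTurnWords, Finset.card_eq_sum_ones, Nat.cast_sum, Finset.sum_filter]
    simp
  rw [hsum]
  have h := tendsto_finsetSum (sawWords (N + 1)) hlim
  refine h.congr fun t => ?_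
  simp only [tailSum]

end Literature.Probability.RandomPlanarGeometry.SAW

namespace Literature.Probability.RandomPlanarGeometry.SAW.Zd

open Literature.Probability.RandomPlanarGeometry.SAW

/-! ### Walk level: `a(N)`, `log μ_AT`, and the three endpoint statements -/

/-- a(N): the number of ALL-TURN `N`-step self-avoiding walks on `ℤ²` (every internal vertex a turn, i.e.
`turns N ω = N - 1`); a-idea-2's body verbatim. [cite: MadrasSlade1993, §1.1] -/
noncomputable def allTurnCount (N : ℕ) : ℕ :=
  ((Zd.saws 2 N).filter fun ω => Zd.turns N ω = N - 1).card

/-- `log μ_AT := inf_N log a(N+1) / (N+1)` (the all-turn growth constant; a-idea-2's body verbatim).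
[cite: MadrasSlade1993, §1.2] -/
noncomputable def logMuAT : ℝ :=
  ⨅ N : ℕ, Real.log (allTurnCount (N + 1)) / ((N : ℝ) + 1)

/-- `a(N)` counted on step words. [cite: MadrasSlade1993, §1.1] -/
theorem allTurnCount_eq_card_allTurnWords (M : ℕ) : allTurnCount M = (allTurnWords M).card := by
  classical
  rw [allTurnCount, ← image_traj_sawWords, Finset.filter_image, allTurnWords]
  rw [Finset.card_image_of_injOn]
  · congr 1
    refine Finset.filter_congr fun w hw => ?_
    rw [turns_traj (mem_sawWords.1 hw).1]
  · intro w hw w' hw' h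
    have hl : w.length = M := (mem_sawWords.1 (Finset.mem_filter.1 (Finset.mem_coe.1 hw)).1).1
    have hl' : w'.length = M := (mem_sawWords.1 (Finset.mem_filter.1 (Finset.mem_coe.1 hw')).1).1
    exact traj_injOn M (by simp [hl]) (by simp [hl']) h

/-- `a(N) ≥ 1` (the staircase). [cite: MadrasSlade1993, §1.1] -/
theorem one_le_allTurnCount (M : ℕ) : 1 ≤ allTurnCount M := by
  rw [allTurnCount_eq_card_allTurnWords]
  exact Finset.card_pos.2 ⟨_, stairWord_mem_allTurnWords M⟩

/-- The terms of `log μ_AT` are `≥ 0`. [cite: MadrasSlade1993, §1.2] -/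
theorem logMuAT_terms_bddBelow :
    BddBelow (Set.range fun N : ℕ => Real.log (allTurnCount (N + 1)) / ((N : ℝ) + 1)) :=
  ⟨0, by
    rintro _ ⟨N, rfl⟩
    show 0 ≤ Real.log (allTurnCount (N + 1)) / ((N : ℝ) + 1)
    exact div_nonneg (Real.log_natCast_nonneg _) (by positivity)⟩

/-- `log μ_AT ≤ log a(N+1)/(N+1)` for every `N`. [cite: MadrasSlade1993, §1.2] -/
theorem logMuAT_le (N : ℕ) : logMuAT ≤ Real.log (allTurnCount (N + 1)) / ((N : ℝ) + 1) :=
  ciInf_le logMuAT_terms_bddBelow N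

/-- The `N`-th term of `κ(t)` for `t ≥ 1`: `log(t Z_{N+1}(t))/(N+1) = log t + log S_N(t)/(N+1)`.
[cite: MadrasSlade1993, §1.2] -/
theorem bendFE_term_eq (N : ℕ) {t : ℝ} (ht : 1 ≤ t) :
    Real.log (max 1 t * Zbend (N + 1) t) / ((N : ℝ) + 1) = Real.log t + Real.log (tailSum N t) / ((N : ℝ) + 1) := by
  have ht0 : 0 < t := by linarith
  have hS : 0 < tailSum N t := lt_of_lt_of_le one_pos (one_le_tailSum N ht0)
  rw [max_eq_right ht, Zbend_succ_eq_pow_mul_tailSum N ht0.ne', ← mul_assoc, ← pow_succ',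
    Real.log_mul (pow_ne_zero _ ht0.ne') hS.ne', Real.log_pow]
  field_simp
  push_cast
  ring

/-- The terms of `κ(t)` are `≥ 0` for `t ≥ 1`. [cite: MadrasSlade1993, §1.2] -/
theorem bendFE_terms_bddBelow_of_one_le {t : ℝ} (ht : 1 ≤ t) :
    BddBelow (Set.range fun N : ℕ => Real.log (max 1 t * Zbend (N + 1) t) / ((N : ℝ) + 1)) :=
  ⟨0, by
    rintro _ ⟨N, rfl⟩
    show 0 ≤ Real.log (max 1 t * Zbend (N + 1) t) / ((N : ℝ) + 1)
    rw [bendFE_term_eq N ht]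
    have h1 : 0 ≤ Real.log t := Real.log_nonneg ht
    have h2 : 0 ≤ Real.log (tailSum N t) := Real.log_nonneg (one_le_tailSum N (by linarith))
    positivity⟩

/-- `κ(t) − log t ≤ log S_N(t)/(N+1)` for every `N` (`t ≥ 1`). [cite: MadrasSlade1993, §1.2] -/
theorem bendFE_sub_log_le (N : ℕ) {t : ℝ} (ht : 1 ≤ t) :
    bendFE t - Real.log t ≤ Real.log (tailSum N t) / ((N : ℝ) + 1) := by
  have h1 : bendFE t ≤ Real.log (max 1 t * Zbend (N + 1) t) / ((N : ℝ) + 1) :=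
    ciInf_le (bendFE_terms_bddBelow_of_one_le ht) N
  rw [bendFE_term_eq N ht] at h1
  linarith

/-- **«STIFF-∞» (i), `EndpointLower`**: `log t + log μ_AT ≤ κ(t)` for every `t ≥ 1` (the all-turn walks alone
contribute `a(N+1) t^N` to `Z_{N+1}(t)`). [cite: MadrasSlade1993, §1.2] -/
theorem endpointLower : ∀ t : ℝ, 1 ≤ t → Real.log t + logMuAT ≤ Zd.bendFE t := by
  intro t ht
  have ht0 : 0 < t := by linarith
  refine le_ciInf fun N => ?_
  rw [bendFE_term_eq N ht]
  have h1 := logMuAT_le N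
  have ha : (0 : ℝ) < allTurnCount (N + 1) := by exact_mod_cast one_le_allTurnCount (N + 1)
  have h2 : Real.log (allTurnCount (N + 1)) ≤ Real.log (tailSum N t) := by
    refine Real.log_le_log ha ?_
    rw [allTurnCount_eq_card_allTurnWords]
    exact card_allTurnWords_le_tailSum N ht0
  have h3 := div_le_div_of_nonneg_right h2 (by positivity : (0 : ℝ) ≤ (N : ℝ) + 1)
  linarith

/-- **«STIFF-∞» (ii), `EndpointAntitone`**: `t ↦ κ(t) − log t` is nonincreasing on `[1, ∞)` (every term of
`S_N(t)` is). [cite: MadrasSlade1993, §1.2] -/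
theorem endpointAntitone : AntitoneOn (fun t : ℝ => Zd.bendFE t - Real.log t) (Set.Ici 1) := by
  intro s hs t ht hst
  have hs1 : (1 : ℝ) ≤ s := hs
  have ht1 : (1 : ℝ) ≤ t := ht
  have key : ∀ N : ℕ, bendFE t - Real.log t ≤ Real.log (tailSum N s) / ((N : ℝ) + 1) := fun N => by
    refine le_trans (bendFE_sub_log_le N ht1) (div_le_div_of_nonneg_right ?_ (by positivity))
    exact Real.log_le_log (lt_of_lt_of_le one_pos (one_le_tailSum N (by linarith)))
      (tailSum_antitoneOn N (show (0 : ℝ) < s by linarith) (show (0 : ℝ) < t by linarith) hst)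
  have h : bendFE t - Real.log t + Real.log s ≤ bendFE s :=
    le_ciInf fun N => by rw [bendFE_term_eq N hs1]; linarith [key N]
  show bendFE t - Real.log t ≤ bendFE s - Real.log s
  linarith

/-- **«STIFF-∞» (iii), `EndpointLimit`**: `κ(t) − log t → log μ_AT` as `t → ∞` (lower bound (i); upper bound:
`κ(t) − log t ≤ log S_N(t)/(N+1) → log a(N+1)/(N+1)` for each `N`). [cite: MadrasSlade1993, §1.2] -/
theorem endpointLimit : Tendsto (fun t : ℝ => Zd.bendFE t - Real.log t) atTop (𝓝 logMuAT) := by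
  rw [tendsto_order]
  constructor
  · intro a ha
    filter_upwards [eventually_ge_atTop (1 : ℝ)] with t ht
    have := endpointLower t ht
    linarith
  · intro b hb
    obtain ⟨N, hN⟩ := exists_lt_of_ciInf_lt hb
    have ha : (0 : ℝ) < allTurnCount (N + 1) := by exact_mod_cast one_le_allTurnCount (N + 1)
    have hlim : Tendsto (fun t : ℝ => Real.log (tailSum N t) / ((N : ℝ) + 1)) atTop
        (𝓝 (Real.log (allTurnCount (N + 1)) / ((N : ℝ) + 1))) := by
      have h := tendsto_tailSum_atTop N
      have hc : ((allTurnWords (N + 1)).card : ℝ) = (allTurnCount (N + 1) : ℝ) := by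
        rw [allTurnCount_eq_card_allTurnWords]
      rw [hc] at h
      exact ((Real.continuousAt_log ha.ne').tendsto.comp h).div_const _
    have hev := (tendsto_order.1 hlim).2 b hN
    filter_upwards [hev, eventually_ge_atTop (1 : ℝ)] with t h1 ht
    exact lt_of_le_of_lt (bendFE_sub_log_le N ht) h1

end Literature.Probability.RandomPlanarGeometry.SAW.Zd

end
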